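import Summits.NavierStokesRegularity.NavierStokesRegularity.Theorems.TypeILiouvilleTypeIliouvilleLWeakL3TailLayerCake
import HarnessLib

/-!
# Blow-down of weak-`L³` slices with a vanishing lower tail (crux `TypeIliouvilleL`,
# stmt-NavierStokesRegularity-10661, persistent stub S3ᵐ): Albritton–Barker's slice condition (b)
# discharged for `o`-weak-`L³` large scales

Helper file (theorems only, no definition, no named fact, no `sorry`; lands
`--supports stmt-NavierStokesRegularity-10661`). Companion of
`TypeILiouvilleTypeIliouvilleLWeakL3Recurrence` / `…WeakL3HeatForm` / `…WeakL3TailLayerCake`.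
After `…WeakL3HeatForm` (condition (a) is automatic for weak-`L³` slices) the only slice hypothesis
left in the weak-`L³` recurrence theorem is the BLOW-DOWN (b): `λ g(λ·) ⇀ 0` as `λ → ∞`. Here (b)
is derived from the VANISHING LOWER TAIL of the distribution function, `s³ · vol{s < |g|} → 0` as
`s → 0⁺` (true for `g ∈ L³` and for `g ∈ L^{3,q}`, `q < ∞`; false for the `−1`-homogeneous tail
`|x|⁻¹`, the obstruction named by Albritton–Barker's `ε(M)`):

* `norm_integral_inner_rescale_le` — the rescaled pairing
  `|∫⟪λ g(λx), φ(x)⟫dx| ≤ λ⁻² ‖φ‖_∞ ∫_{B̄_{λR}}|g|` (`supp φ ⊆ B̄_R`);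
* `tendsto_integral_inner_rescale_of_weakL3_of_tail` — (b) holds for every weak-`L³` `g` with
  vanishing lower tail;
* `oseenMild_const_of_backward_weakL3_const_of_tail` — a mild bounded ancient solution with a
  uniform weak-`L³` bound of `v(τ_k) − b` along `τ_k → −∞` and ONE slice `v(τ_{k₀}) − b` whose
  distribution function has vanishing lower tail is the constant `b` on the whole slab (no Besov /
  blow-down hypothesis left).

Nothing here proves S3ᵐ, (L), or anything about Navier–Stokes regularity.
-/

set_option linter.dupNamespace false

namespace Summit.NavierStokesRegularity.NavierStokesRegularity.Theorems

open MeasureTheory Filter Set Function Metric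
open scoped ENNReal NNReal Topology RealInnerProductSpace
open Literature.Analysis Literature.Analysis.FluidPDE

/-- **The Navier–Stokes rescaled pairing against a test field is controlled by the mass on a
ball.** For `g, φ : ℝ³ → ℝ³` with `‖φ‖ ≤ C` everywhere and `φ = 0` off `B̄(0,R)`, and `λ > 0`:
`|∫ ⟪λ g(λx), φ(x)⟫ dx| ≤ λ⁻² · C · X` whenever `∫_{B̄(0,λR)} ‖g‖ ≤ X` (substitution `y = λx`,
`dy = λ³dx`). [folklore] -/
theorem norm_integral_inner_rescale_le
    (g φ : EuclideanSpace ℝ (Fin 3) → EuclideanSpace ℝ (Fin 3)) {C R : ℝ} (hC0 : 0 ≤ C)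
    (hC : ∀ x, ‖φ x‖ ≤ C) (hR : ∀ x, φ x ≠ 0 → ‖x‖ ≤ R)
    {lam : ℝ} (hlam : 0 < lam) {X : ℝ} (hX0 : 0 ≤ X)
    (hX : ∫⁻ y in closedBall (0 : EuclideanSpace ℝ (Fin 3)) (lam * R), ‖g y‖ₑ ≤ ENNReal.ofReal X) :
    ‖∫ x, ⟪lam • g (lam • x), φ x⟫‖ ≤ (lam ^ 2)⁻¹ * (C * X) := by
  have hne : lam ≠ 0 := hlam.ne'
  -- substitution `y = λ x`
  set I : ℝ := ∫ y, ⟪g y, φ (lam⁻¹ • y)⟫ with hI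
  have hsub : ∫ x, ⟪lam • g (lam • x), φ x⟫ = (lam ^ 3)⁻¹ * (lam * I) := by
    have hfun : (fun x : EuclideanSpace ℝ (Fin 3) => ⟪lam • g (lam • x), φ x⟫) =
        fun x => (fun y => ⟪lam • g y, φ (lam⁻¹ • y)⟫) (lam • x) := by
      funext x
      simp only [inv_smul_smul₀ hne]
    rw [hfun, Measure.integral_comp_smul (μ := volume) (fun y => ⟪lam • g y, φ (lam⁻¹ • y)⟫) lam,
      finrank_euclideanSpace_fin, abs_of_pos (inv_pos.2 (pow_pos hlam 3)), smul_eq_mul]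
    congr 1
    simp_rw [real_inner_smul_left]
    exact integral_const_mul _ _
  -- the pairing at scale one is bounded by the mass on `B̄(0, λR)`
  have hpt : ∀ y, ‖⟪g y, φ (lam⁻¹ • y)⟫‖ₑ ≤
      (closedBall (0 : EuclideanSpace ℝ (Fin 3)) (lam * R)).indicator (fun y => ‖g y‖ₑ) y *
        ENNReal.ofReal C := by
    intro y
    by_cases hφ : φ (lam⁻¹ • y) = 0
    · simp [hφ]
    · have hy : y ∈ closedBall (0 : EuclideanSpace ℝ (Fin 3)) (lam * R) := by
        have h1 := hR _ hφ
        rw [norm_smul, norm_inv, Real.norm_of_nonneg hlam.le] at h1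
        rw [mem_closedBall, dist_zero_right]
        rwa [inv_mul_le_iff₀ hlam] at h1
      rw [indicator_of_mem hy, ← ofReal_norm, ← ofReal_norm, ← ENNReal.ofReal_mul (norm_nonneg _)]
      exact ENNReal.ofReal_le_ofReal ((norm_inner_le_norm _ _).trans
        (mul_le_mul_of_nonneg_left (hC _) (norm_nonneg _)))
  have hIe : ‖I‖ₑ ≤ ENNReal.ofReal (X * C) := by
    calc ‖I‖ₑ ≤ ∫⁻ y, ‖⟪g y, φ (lam⁻¹ • y)⟫‖ₑ := enorm_integral_le_lintegral_enorm _
      _ ≤ ∫⁻ y, (closedBall (0 : EuclideanSpace ℝ (Fin 3)) (lam * R)).indicator (fun y => ‖g y‖ₑ) y *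
            ENNReal.ofReal C := lintegral_mono hpt
      _ = (∫⁻ y in closedBall (0 : EuclideanSpace ℝ (Fin 3)) (lam * R), ‖g y‖ₑ) * ENNReal.ofReal C := by
          rw [lintegral_mul_const' _ _ ENNReal.ofReal_ne_top, lintegral_indicator measurableSet_closedBall]
      _ ≤ ENNReal.ofReal X * ENNReal.ofReal C := by gcongr
      _ = ENNReal.ofReal (X * C) := (ENNReal.ofReal_mul hX0).symm
  have hIr : ‖I‖ ≤ X * C := by
    rw [← ofReal_norm] at hIe
    exact (ENNReal.ofReal_le_ofReal_iff (by positivity)).1 hIe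
  rw [hsub, norm_mul, norm_mul, norm_inv, norm_pow, Real.norm_of_nonneg hlam.le]
  calc (lam ^ 3)⁻¹ * (lam * ‖I‖) ≤ (lam ^ 3)⁻¹ * (lam * (X * C)) := by gcongr
    _ = (lam ^ 2)⁻¹ * (C * X) := by field_simp

set_option maxHeartbeats 400000 in
/-- **Blow-down of weak-`L³` functions with a vanishing lower tail.** If `g : ℝ³ → ℝ³` is
a.e.-strongly measurable with `s³·vol{s < ‖g‖} ≤ M < ∞` for all `s > 0` and
`s³·vol{s < ‖g‖} → 0` as `s → 0⁺`, then `λ g(λ·) ⇀ 0`: for every smooth compactly supported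
`φ`, `∫ ⟪λ g(λx), φ(x)⟫ dx → 0` as `λ → ∞`. (Proof: by `norm_integral_inner_rescale_le` and
`setLIntegral_closedBall_enorm_le_of_weakL3_of_tail` with `η = θ/λ`,
`|∫⟪λg(λx),φ⟫| ≤ ‖φ‖_∞(θR³|B̄₁| + 3d/(2θ²) + M/(2s₁²λ²))`, and `θ`, `d`, `s₁`, `λ` are chosen
in this order.) This is condition (b) of Albritton–Barker's class `𝔹` for such slices.
[cite: AlbrittonBarker2019, §4 before Thm 4.1 (arXiv:1811.00502 p. 9), definition of 𝔹] -/
theorem tendsto_integral_inner_rescale_of_weakL3_of_tail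
    {g : EuclideanSpace ℝ (Fin 3) → EuclideanSpace ℝ (Fin 3)} (hg : AEStronglyMeasurable g volume)
    {M : ℝ≥0∞} (hM : M ≠ ∞)
    (hweak : ∀ s : ℝ, 0 < s →
      ENNReal.ofReal s ^ 3 * (volume : Measure (EuclideanSpace ℝ (Fin 3))) {x | s < ‖g x‖} ≤ M)
    (htail : Tendsto (fun s : ℝ =>
      ENNReal.ofReal s ^ 3 * (volume : Measure (EuclideanSpace ℝ (Fin 3))) {x | s < ‖g x‖})
      (𝓝[>] 0) (𝓝 0))
    (φ : EuclideanSpace ℝ (Fin 3) → EuclideanSpace ℝ (Fin 3))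
    (hφ : FunctionSpaces.IsTestFunctionOn (⊤ : TopologicalSpace.Opens (EuclideanSpace ℝ (Fin 3))) φ) :
    Tendsto (fun lam : ℝ => ∫ x, ⟪lam • g (lam • x), φ x⟫) atTop (𝓝 0) := by
  -- size and support of `φ`
  obtain ⟨C, hC⟩ := hφ.contDiff.continuous.bounded_above_of_compact_support hφ.hasCompactSupport
  have hC0 : 0 ≤ C := (norm_nonneg _).trans (hC 0)
  obtain ⟨R₀, hR₀⟩ := hφ.hasCompactSupport.isCompact.isBounded.subset_closedBall (0 : EuclideanSpace ℝ (Fin 3))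
  set R : ℝ := max R₀ 1 with hRdef
  have hR1 : 1 ≤ R := le_max_right _ _
  have hR0 : 0 < R := one_pos.trans_le hR1
  have hR : ∀ x, φ x ≠ 0 → ‖x‖ ≤ R := by
    intro x hx
    have h1 : x ∈ closedBall (0 : EuclideanSpace ℝ (Fin 3)) R₀ := hR₀ (subset_tsupport _ hx)
    rw [mem_closedBall, dist_zero_right] at h1
    exact h1.trans (le_max_left _ _)
  set m : ℝ := M.toReal with hm
  have hm0 : 0 ≤ m := ENNReal.toReal_nonneg
  set v₁ : ℝ := ((volume : Measure (EuclideanSpace ℝ (Fin 3))) (closedBall 0 1)).toReal with hv₁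
  have hv₁0 : 0 ≤ v₁ := ENNReal.toReal_nonneg
  rw [Metric.tendsto_atTop]
  intro ε hε
  -- the three parameters
  set θ : ℝ := ε / (3 * (C * R ^ 3 * v₁ + 1)) with hθ
  have hK0 : 0 < C * R ^ 3 * v₁ + 1 := by positivity
  have hθ0 : 0 < θ := by positivity
  set d : ℝ := ε * θ ^ 2 / (9 * (C + 1)) with hd
  have hd0 : 0 < d := by positivity
  -- `s₁` from the vanishing lower tail
  have hev : ∀ᶠ s in 𝓝[>] (0 : ℝ),
      ENNReal.ofReal s ^ 3 * (volume : Measure (EuclideanSpace ℝ (Fin 3))) {x | s < ‖g x‖} <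
        ENNReal.ofReal d :=
    htail (Iio_mem_nhds (ENNReal.ofReal_pos.2 hd0))
  obtain ⟨b, hb0, hb⟩ := (nhdsGT_basis (0 : ℝ)).eventually_iff.1 hev
  set s₁ : ℝ := b / 2 with hs₁
  have hs₁0 : 0 < s₁ := by positivity
  have hs₁b : s₁ < b := by rw [hs₁]; linarith
  have htail' : ∀ s : ℝ, 0 < s → s ≤ s₁ →
      ENNReal.ofReal s ^ 3 * (volume : Measure (EuclideanSpace ℝ (Fin 3))) {x | s < ‖g x‖} ≤
        ENNReal.ofReal d :=
    fun s hs hss => (hb ⟨hs, hss.trans_lt hs₁b⟩).le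
  -- the threshold
  set N : ℝ := max (max 1 (θ / s₁)) (3 * (C + 1) * (m + 1) / (s₁ ^ 2 * ε)) with hN
  refine ⟨N, fun lam hlam => ?_⟩
  have hlam1 : 1 ≤ lam := ((le_max_left _ _).trans (le_max_left _ _)).trans hlam
  have hlam0 : 0 < lam := one_pos.trans_le hlam1
  have hlamθ : θ / s₁ ≤ lam := ((le_max_right _ _).trans (le_max_left _ _)).trans hlam
  have hlam3 : 3 * (C + 1) * (m + 1) / (s₁ ^ 2 * ε) ≤ lam := (le_max_right _ _).trans hlam
  -- level `η = θ/λ`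
  set η : ℝ := θ / lam with hη
  have hη0 : 0 < η := div_pos hθ0 hlam0
  have hηs : η ≤ s₁ := by
    rw [hη, div_le_iff₀ hlam0]
    rw [div_le_iff₀ hs₁0] at hlamθ
    linarith
  -- the mass bound on `B̄(0, λR)` and the pairing bound
  have hmass := setLIntegral_closedBall_enorm_le_of_weakL3_of_tail hg hM hweak hd0.le hη0 hηs
    (fun s hs hss => htail' s (hη0.trans_le hs) hss) (Λ := lam * R) (by positivity)
  set X : ℝ := η * (lam * R) ^ 3 * v₁ + (3 * d / (2 * η ^ 2) + m / (2 * s₁ ^ 2)) with hX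
  have hX0 : 0 ≤ X := by positivity
  have hbound := norm_integral_inner_rescale_le g φ hC0 hC hR hlam0 hX0 hmass
  rw [dist_zero_right]
  refine lt_of_le_of_lt hbound ?_
  -- arithmetic: the three terms are `≤ ε/3`, `≤ ε/6`, `≤ ε/3`
  have hlam2 : lam ≤ lam ^ 2 := by nlinarith
  have ht1 : (lam ^ 2)⁻¹ * (C * (η * (lam * R) ^ 3 * v₁)) = C * R ^ 3 * v₁ * θ := by
    rw [hη]; field_simp
  have ht1' : C * R ^ 3 * v₁ * θ ≤ ε / 3 := by
    rw [hθ]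
    rw [show C * R ^ 3 * v₁ * (ε / (3 * (C * R ^ 3 * v₁ + 1))) =
        (ε / 3) * ((C * R ^ 3 * v₁) / (C * R ^ 3 * v₁ + 1)) by field_simp]
    refine mul_le_of_le_one_right (by positivity) ?_
    rw [div_le_one hK0]; linarith
  have ht2 : (lam ^ 2)⁻¹ * (C * (3 * d / (2 * η ^ 2))) = C * (3 * d) / (2 * θ ^ 2) := by
    rw [hη]; field_simp
  have ht2' : C * (3 * d) / (2 * θ ^ 2) ≤ ε / 6 := by
    rw [hd]
    rw [show C * (3 * (ε * θ ^ 2 / (9 * (C + 1)))) / (2 * θ ^ 2) = (ε / 6) * (C / (C + 1)) by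
      field_simp; ring]
    refine mul_le_of_le_one_right (by positivity) ?_
    rw [div_le_one (by positivity)]; linarith
  have ht3 : (lam ^ 2)⁻¹ * (C * (m / (2 * s₁ ^ 2))) ≤ ε / 3 := by
    rw [div_le_iff₀ (by positivity)] at hlam3
    have h1 : 3 * (C + 1) * (m + 1) ≤ lam ^ 2 * (s₁ ^ 2 * ε) :=
      hlam3.trans (mul_le_mul_of_nonneg_right hlam2 (by positivity))
    have h2 : C * m ≤ (C + 1) * (m + 1) := by nlinarith
    rw [inv_mul_le_iff₀ (by positivity)]
    have h3 : C * (m / (2 * s₁ ^ 2)) = C * m / (2 * s₁ ^ 2) := by ring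
    rw [h3, div_le_iff₀ (by positivity)]
    nlinarith
  calc (lam ^ 2)⁻¹ * (C * X)
      = (lam ^ 2)⁻¹ * (C * (η * (lam * R) ^ 3 * v₁)) + (lam ^ 2)⁻¹ * (C * (3 * d / (2 * η ^ 2))) +
          (lam ^ 2)⁻¹ * (C * (m / (2 * s₁ ^ 2))) := by rw [hX]; ring
    _ ≤ ε / 3 + ε / 6 + ε / 3 := by
        rw [ht1, ht2]
        exact add_le_add (add_le_add ht1' ht2') ht3
    _ < ε := by linarith

/-- **Weak-`L³` recurrence with ONE slice of vanishing lower tail kills a mild bounded ancient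
solution on the whole slab — both of Albritton–Barker's slice conditions discharged.** Let `v` be
continuous and uniformly bounded on `(−∞,0) × ℝ³`, weakly divergence free on every slice and
Oseen-mild, with negative times `τ_k → −∞` and a finite `M` such that
`s³ · vol{x : s < ‖v(τ_k,x) − b‖} ≤ M` for all `s > 0` and all `k`. If at ONE index `k₀` the
distribution function of the slice has vanishing lower tail,
`s³ · vol{x : s < ‖v(τ_{k₀},x) − b‖} → 0` as `s → 0⁺` (e.g. `v(τ_{k₀}) − b ∈ L³` or `∈ L^{3,q}`,
`q < ∞`), then `v(t,x) = b` for all `t < 0` and all `x`. Proof: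
`oseenMild_const_of_backward_weakL3_const_at_recurrence` with (b) supplied by
`tendsto_integral_inner_rescale_of_weakL3_of_tail` for the translate
`y ↦ v(τ_{k₀})(y + τ_{k₀}b) − b` (same distribution function, by translation invariance of Lebesgue
measure). [cite: AlbrittonBarker2019, Thm 4.1 (arXiv:1811.00502 §4 p. 9)] -/
theorem oseenMild_const_of_backward_weakL3_const_of_tail
    (v : ℝ → EuclideanSpace ℝ (Fin 3) → EuclideanSpace ℝ (Fin 3)) (b : EuclideanSpace ℝ (Fin 3))
    (hvc : ContinuousOn (uncurry v) (Iio 0 ×ˢ univ))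
    (hvK : ∃ K : ℝ, ∀ t < 0, ∀ x, ‖v t x‖ ≤ K)
    (hvd : ∀ t < 0, IsWeaklyDivFree (v t))
    (hvm : ∀ s t : ℝ, s < t → t < 0 → ∀ x,
      v t x = UnboundedOperators.heatExtension (v s) (t - s) x - oseenDuhamel 1 s v v t x)
    {τ : ℕ → ℝ} {M : ℝ≥0∞} (hM : M < ∞) (hτ : Tendsto τ atTop atBot) (hτ0 : ∀ k, τ k < 0)
    (hwk : ∀ (k : ℕ) (s : ℝ), 0 < s →
      ENNReal.ofReal s ^ 3 *
        (volume : Measure (EuclideanSpace ℝ (Fin 3))) {x | s < ‖v (τ k) x - b‖} ≤ M)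
    {k₀ : ℕ}
    (htail : Tendsto (fun s : ℝ => ENNReal.ofReal s ^ 3 *
        (volume : Measure (EuclideanSpace ℝ (Fin 3))) {x | s < ‖v (τ k₀) x - b‖})
      (𝓝[>] 0) (𝓝 0)) :
    ∀ t < 0, ∀ x, v t x = b := by
  -- the translated slice `g(y) = v(τ k₀)(y + τ k₀ • b) − b`
  set g : EuclideanSpace ℝ (Fin 3) → EuclideanSpace ℝ (Fin 3) :=
    fun y => v (τ k₀) (y + τ k₀ • b) - b with hg_def
  have hcontv : Continuous (v (τ k₀)) :=
    hvc.comp_continuous (continuous_const.prodMk continuous_id) fun y => ⟨hτ0 k₀, mem_univ y⟩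
  have hgc : Continuous g := (hcontv.comp (continuous_id.add continuous_const)).sub continuous_const
  -- same distribution function as `v(τ k₀) − b`
  have hset : ∀ s : ℝ, {y | s < ‖g y‖} = (fun y => y + τ k₀ • b) ⁻¹' {x | s < ‖v (τ k₀) x - b‖} :=
    fun s => rfl
  have hdist : ∀ s : ℝ, (volume : Measure (EuclideanSpace ℝ (Fin 3))) {y | s < ‖g y‖} =
      volume {x | s < ‖v (τ k₀) x - b‖} := fun s => by
    rw [hset, measure_preimage_add_right]
  have hweak_g : ∀ s : ℝ, 0 < s →
      ENNReal.ofReal s ^ 3 * (volume : Measure (EuclideanSpace ℝ (Fin 3))) {y | s < ‖g y‖} ≤ M :=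
    fun s hs => by rw [hdist]; exact hwk k₀ s hs
  have htail_g : Tendsto (fun s : ℝ =>
      ENNReal.ofReal s ^ 3 * (volume : Measure (EuclideanSpace ℝ (Fin 3))) {y | s < ‖g y‖})
      (𝓝[>] 0) (𝓝 0) := by
    simp_rw [hdist]; exact htail
  have hB : ∀ φ : EuclideanSpace ℝ (Fin 3) → EuclideanSpace ℝ (Fin 3),
      FunctionSpaces.IsTestFunctionOn (⊤ : TopologicalSpace.Opens (EuclideanSpace ℝ (Fin 3))) φ →
      Tendsto (fun lam : ℝ => ∫ x, ⟪lam • (v (τ k₀) (lam • x + τ k₀ • b) - b), φ x⟫) atTop (𝓝 0) :=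
    fun φ hφ => tendsto_integral_inner_rescale_of_weakL3_of_tail hgc.aestronglyMeasurable hM.ne
      hweak_g htail_g φ hφ
  exact oseenMild_const_of_backward_weakL3_const_at_recurrence v b hvc hvK hvd hvm hM hτ hτ0 hwk hB

/-- **The case `b = 0`: Albritton–Barker's Theorem 4.1 with both slice conditions discharged at a
recurrence time.** A field `v`, continuous and uniformly bounded on `(−∞,0) × ℝ³`, weakly
divergence free on every slice and Oseen-mild, with a uniform weak-`L³` bound
`s³ · vol{s < ‖v(τ_k)‖} ≤ M < ∞` along negative times `τ_k → −∞`, ONE of whose slices `v(τ_{k₀})`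
has a distribution function with vanishing lower tail (`s³ · vol{s < ‖v(τ_{k₀})‖} → 0` as
`s → 0⁺`; e.g. `v(τ_{k₀}) ∈ L³`), vanishes identically on the slab.
[cite: AlbrittonBarker2019, Thm 4.1 (arXiv:1811.00502 §4 p. 9)] -/
theorem oseenMild_eq_zero_of_backward_weakL3_of_tail
    (v : ℝ → EuclideanSpace ℝ (Fin 3) → EuclideanSpace ℝ (Fin 3))
    (hvc : ContinuousOn (uncurry v) (Iio 0 ×ˢ univ))
    (hvK : ∃ K : ℝ, ∀ t < 0, ∀ x, ‖v t x‖ ≤ K)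
    (hvd : ∀ t < 0, IsWeaklyDivFree (v t))
    (hvm : ∀ s t : ℝ, s < t → t < 0 → ∀ x,
      v t x = UnboundedOperators.heatExtension (v s) (t - s) x - oseenDuhamel 1 s v v t x)
    {τ : ℕ → ℝ} {M : ℝ≥0∞} (hM : M < ∞) (hτ : Tendsto τ atTop atBot) (hτ0 : ∀ k, τ k < 0)
    (hwk : ∀ (k : ℕ) (s : ℝ), 0 < s →
      ENNReal.ofReal s ^ 3 *
        (volume : Measure (EuclideanSpace ℝ (Fin 3))) {x | s < ‖v (τ k) x‖} ≤ M)
    {k₀ : ℕ}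
    (htail : Tendsto (fun s : ℝ => ENNReal.ofReal s ^ 3 *
        (volume : Measure (EuclideanSpace ℝ (Fin 3))) {x | s < ‖v (τ k₀) x‖})
      (𝓝[>] 0) (𝓝 0)) :
    ∀ t < 0, ∀ x, v t x = 0 := by
  have hwk' : ∀ (k : ℕ) (s : ℝ), 0 < s →
      ENNReal.ofReal s ^ 3 *
        (volume : Measure (EuclideanSpace ℝ (Fin 3))) {x | s < ‖v (τ k) x - 0‖} ≤ M := by
    simpa only [sub_zero] using hwk
  have htail' : Tendsto (fun s : ℝ => ENNReal.ofReal s ^ 3 *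
        (volume : Measure (EuclideanSpace ℝ (Fin 3))) {x | s < ‖v (τ k₀) x - 0‖})
      (𝓝[>] 0) (𝓝 0) := by
    simpa only [sub_zero] using htail
  exact oseenMild_const_of_backward_weakL3_const_of_tail v 0 hvc hvK hvd hvm hM hτ hτ0 hwk' htail'

end Summit.NavierStokesRegularity.NavierStokesRegularity.Theorems
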